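import Summits.Ventures.PercRepro.C041RcPortINV
import Summits.Ventures.PercRepro.C041ZoneReduction

/-!
# From the REDUCTION THEOREM's inequality to CONJECTURE (INV) on the O-cube (p6, gen 26; C-041.md §11, «12 ∈ E»)

The REDUCTION THEOREM of C-041.md §11 bounds `#{σ : invalid ∧ ¬ρ_t(u″)}` above and `#{σ : valid ∧ ¬G_t ∧ ρ_t(u″)}`
below (the abstract layer is `C041ZoneReduction`); CONJECTURE (INV) (`C041RcPortINV`) reads `#{invalid} ≤ m_t(u″)`
with `m_t(u″) = #{¬G_t ∧ ρ_t(u″)}`.  The two are equivalent ways of counting once `invalid ⟹ ¬G_t` — which is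
where `12 ∈ E` enters: in an admissible state every edge between the terminals is red, so a red walk from the probe
to one terminal joins it to both.

* `card_filter_le_of_reduced` (pure counting): `inv → ¬ good` and `#{inv ∧ ¬rho} ≤ #{¬inv ∧ ¬good ∧ rho}` give
  `#{inv} ≤ #{¬good ∧ rho}`;
* `red_of_joins_terminals`, `not_goodA_of_rcInvalid` / `not_goodB_of_rcInvalid`: the `12 ∈ E` facts on cube states;
* **`invalidCount_le_mCountA_of_reduced`** / **`…B…`**: with an edge between the terminals, the inequality of the
  REDUCTION THEOREM at `(O, u)` (`invNotRhoCountA O u ≤ validNotGoodRhoCountA O u`) gives the (INV) inequality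
  `invalidCount O ≤ mCountA O u`; `INVConj_of_reduced` assembles `INVConj`.

NOT claimed: the inequality itself (the ZONE LEMMA and the percolation dictionary of §11 are not typed).
-/

namespace PercRepro

namespace ZoneReduction

open Finset

variable {α : Type*} [DecidableEq α] (s : Finset α) (inv rho good : α → Prop)
  [DecidablePred inv] [DecidablePred rho] [DecidablePred good]

/-- **Counting**: when `inv → ¬ good`, the reduced inequality `#{inv ∧ ¬rho} ≤ #{¬inv ∧ ¬good ∧ rho}` gives
`#{inv} ≤ #{¬good ∧ rho}` (add the states with `inv ∧ rho` to both sides). -/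
theorem card_filter_le_of_reduced (hig : ∀ σ ∈ s, inv σ → ¬ good σ)
    (h : (s.filter fun σ => inv σ ∧ ¬ rho σ).card ≤ (s.filter fun σ => ¬ inv σ ∧ ¬ good σ ∧ rho σ).card) :
    (s.filter inv).card ≤ (s.filter fun σ => ¬ good σ ∧ rho σ).card := by
  have hL : s.filter inv = (s.filter fun σ => inv σ ∧ ¬ rho σ) ∪ (s.filter fun σ => inv σ ∧ rho σ) := by
    ext σ
    simp only [Finset.mem_filter, Finset.mem_union]
    constructor
    · rintro ⟨hs, hi⟩
      by_cases hr : rho σ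
      · exact Or.inr ⟨hs, hi, hr⟩
      · exact Or.inl ⟨hs, hi, hr⟩
    · rintro (⟨hs, hi, _⟩ | ⟨hs, hi, _⟩) <;> exact ⟨hs, hi⟩
  have hdL : Disjoint (s.filter fun σ => inv σ ∧ ¬ rho σ) (s.filter fun σ => inv σ ∧ rho σ) := by
    rw [Finset.disjoint_left]
    intro σ h1 h2
    rw [Finset.mem_filter] at h1 h2
    exact h1.2.2 h2.2.2
  have hR : (s.filter fun σ => ¬ inv σ ∧ ¬ good σ ∧ rho σ) ∪ (s.filter fun σ => inv σ ∧ rho σ)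
      ⊆ s.filter fun σ => ¬ good σ ∧ rho σ := by
    intro σ hσ
    rw [Finset.mem_union, Finset.mem_filter, Finset.mem_filter] at hσ
    rw [Finset.mem_filter]
    rcases hσ with ⟨hs, _, hg, hr⟩ | ⟨hs, hi, hr⟩
    · exact ⟨hs, hg, hr⟩
    · exact ⟨hs, hig σ hs hi, hr⟩
  have hdR : Disjoint (s.filter fun σ => ¬ inv σ ∧ ¬ good σ ∧ rho σ) (s.filter fun σ => inv σ ∧ rho σ) := by
    rw [Finset.disjoint_left]
    intro σ h1 h2
    rw [Finset.mem_filter] at h1 h2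
    exact h1.2.1 h2.2.1
  calc (s.filter inv).card
      = (s.filter fun σ => inv σ ∧ ¬ rho σ).card + (s.filter fun σ => inv σ ∧ rho σ).card := by
        rw [hL, Finset.card_union_of_disjoint hdL]
    _ ≤ (s.filter fun σ => ¬ inv σ ∧ ¬ good σ ∧ rho σ).card + (s.filter fun σ => inv σ ∧ rho σ).card :=
        Nat.add_le_add_right h _
    _ = ((s.filter fun σ => ¬ inv σ ∧ ¬ good σ ∧ rho σ) ∪ (s.filter fun σ => inv σ ∧ rho σ)).card := by
        rw [Finset.card_union_of_disjoint hdR]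
    _ ≤ (s.filter fun σ => ¬ good σ ∧ rho σ).card := Finset.card_le_card hR

end ZoneReduction

namespace MultiGraph

open Finset

variable {V E : Type*} {G : MultiGraph V E}

section TwelveInE

variable (a b c : V)

/-- In a cube state every edge between the terminals is red (the terminals are blue-separated). -/
theorem red_of_joins_terminals [Fintype V] [Fintype E] [DecidableEq E] {O S : Config E}
    (hS : G.IsCubeState a b c O S) {e : E} (he : G.Joins e a b) : S e = true := by
  by_contra h
  have hblue : Sᶜ e = true := by
    rw [compl_apply_not]
    cases hSe : S e
    · rfl
    · exact absurd hSe h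
  exact hS.2.2.2.2 (Conn.of_openAdj ⟨e, hblue, he⟩)

/-- A walk avoiding a set is a connection. -/
theorem conn_of_walkAvoiding {S : Config E} {W : Set V} {u v : V} (h : G.WalkAvoiding S W u v) :
    G.Conn S u v := by
  obtain ⟨-, hw⟩ := h
  induction hw with
  | refl => exact Conn.refl G S u
  | tail _ hbc ih => exact ih.trans (Conn.of_openAdj hbc.1)

/-- **`12 ∈ E`, side `a`**: with an edge between the terminals, an invalid cube state is not `Good_a` (a red walk from
the probe to `b` would join the probe to both terminals through the red terminal edge). -/
theorem not_goodA_of_rcInvalid [Fintype V] [Fintype E] [DecidableEq E] (hab : ∃ e, G.Joins e a b)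
    {O S : Config E} (hS : G.IsCubeState a b c O S) (hinv : G.RcInvalid a b c S) :
    ¬ G.WalkAvoiding S (G.cluster Sᶜ a) c b := by
  intro hw
  obtain ⟨e, he⟩ := hab
  have hcb : G.Conn S c b := conn_of_walkAvoiding hw
  have hba : G.Conn S b a := Conn.of_openAdj ⟨e, red_of_joins_terminals a b c hS he, he.symm⟩
  exact hinv ⟨hcb.trans hba, hcb⟩

/-- **`12 ∈ E`, side `b`**: an invalid cube state is not `Good_b`. -/
theorem not_goodB_of_rcInvalid [Fintype V] [Fintype E] [DecidableEq E] (hab : ∃ e, G.Joins e a b)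
    {O S : Config E} (hS : G.IsCubeState a b c O S) (hinv : G.RcInvalid a b c S) :
    ¬ G.WalkAvoiding S (G.cluster Sᶜ b) c a := by
  intro hw
  obtain ⟨e, he⟩ := hab
  have hca : G.Conn S c a := conn_of_walkAvoiding hw
  have hab' : G.Conn S a b := Conn.of_openAdj ⟨e, red_of_joins_terminals a b c hS he, he⟩
  exact hinv ⟨hca, hca.trans hab'⟩

end TwelveInE

section Reduced

variable [Fintype V] [Fintype E] [DecidableEq E] (a b c : V)

open Classical in
/-- The left side of the REDUCTION THEOREM at `(O, u)`, side `a`: `#{invalid ∧ ¬ρ_a(u)}`. -/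
noncomputable def invNotRhoCountA (G : MultiGraph V E) (a b c : V) (O : Config E) (u : V) : ℕ :=
  ((G.cubeStateSet a b c O).filter fun S => G.RcInvalid a b c S ∧ ¬ G.RhoA a c S u).card

open Classical in
/-- The right side of the REDUCTION THEOREM at `(O, u)`, side `a`: `#{valid ∧ ¬Good_a ∧ ρ_a(u)}`. -/
noncomputable def validNotGoodRhoCountA (G : MultiGraph V E) (a b c : V) (O : Config E) (u : V) : ℕ :=
  ((G.cubeStateSet a b c O).filter fun S =>
    ¬ G.RcInvalid a b c S ∧ ¬ G.WalkAvoiding S (G.cluster Sᶜ a) c b ∧ G.RhoA a c S u).card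

open Classical in
/-- The left side of the REDUCTION THEOREM at `(O, u)`, side `b`: `#{invalid ∧ ¬ρ_b(u)}`. -/
noncomputable def invNotRhoCountB (G : MultiGraph V E) (a b c : V) (O : Config E) (u : V) : ℕ :=
  ((G.cubeStateSet a b c O).filter fun S => G.RcInvalid a b c S ∧ ¬ G.RhoB b c S u).card

open Classical in
/-- The right side of the REDUCTION THEOREM at `(O, u)`, side `b`: `#{valid ∧ ¬Good_b ∧ ρ_b(u)}`. -/
noncomputable def validNotGoodRhoCountB (G : MultiGraph V E) (a b c : V) (O : Config E) (u : V) : ℕ :=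
  ((G.cubeStateSet a b c O).filter fun S =>
    ¬ G.RcInvalid a b c S ∧ ¬ G.WalkAvoiding S (G.cluster Sᶜ b) c a ∧ G.RhoB b c S u).card

open Classical in
/-- **(INV) at `(O, u)`, side `a`, from the REDUCTION THEOREM's inequality** (C-041.md §11, `12 ∈ E`):
`#{invalid ∧ ¬ρ_a(u)} ≤ #{valid ∧ ¬Good_a ∧ ρ_a(u)}` gives `I(O) ≤ m_a(u)`. -/
theorem invalidCount_le_mCountA_of_reduced (hab : ∃ e, G.Joins e a b) (O : Config E) (u : V)
    (h : G.invNotRhoCountA a b c O u ≤ G.validNotGoodRhoCountA a b c O u) :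
    G.invalidCount a b c O ≤ G.mCountA a b c O u := by
  unfold invalidCount mCountA
  unfold invNotRhoCountA validNotGoodRhoCountA at h
  refine ZoneReduction.card_filter_le_of_reduced (G.cubeStateSet a b c O) (G.RcInvalid a b c)
    (fun S => G.RhoA a c S u) (fun S => G.WalkAvoiding S (G.cluster Sᶜ a) c b) ?_ h
  intro S hS hinv
  unfold cubeStateSet at hS
  rw [Finset.mem_filter] at hS
  exact not_goodA_of_rcInvalid a b c hab hS.2 hinv

open Classical in
/-- **(INV) at `(O, u)`, side `b`, from the REDUCTION THEOREM's inequality**: `I(O) ≤ m_b(u)`. -/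
theorem invalidCount_le_mCountB_of_reduced (hab : ∃ e, G.Joins e a b) (O : Config E) (u : V)
    (h : G.invNotRhoCountB a b c O u ≤ G.validNotGoodRhoCountB a b c O u) :
    G.invalidCount a b c O ≤ G.mCountB a b c O u := by
  unfold invalidCount mCountB
  unfold invNotRhoCountB validNotGoodRhoCountB at h
  refine ZoneReduction.card_filter_le_of_reduced (G.cubeStateSet a b c O) (G.RcInvalid a b c)
    (fun S => G.RhoB b c S u) (fun S => G.WalkAvoiding S (G.cluster Sᶜ b) c a) ?_ h
  intro S hS hinv
  unfold cubeStateSet at hS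
  rw [Finset.mem_filter] at hS
  exact not_goodB_of_rcInvalid a b c hab hS.2 hinv

/-- **CONJECTURE (INV) from the REDUCTION THEOREM's inequalities** (`12 ∈ E`): if at every `(O, u)` with `u ∈ K(O)`
free of terminal edges both reduced inequalities hold, then `INVConj`. -/
theorem INVConj_of_reduced (hab : ∃ e, G.Joins e a b)
    (h : ∀ (O : Config E) (u : V), u ∈ G.BareReach a b c O → (¬ ∃ e, G.Joins e u a ∨ G.Joins e u b) →
      G.invNotRhoCountA a b c O u ≤ G.validNotGoodRhoCountA a b c O u ∧
        G.invNotRhoCountB a b c O u ≤ G.validNotGoodRhoCountB a b c O u) :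
    G.INVConj a b c := by
  intro O u hu hfree
  obtain ⟨hA, hB⟩ := h O u hu hfree
  exact ⟨invalidCount_le_mCountA_of_reduced a b c hab O u hA,
    invalidCount_le_mCountB_of_reduced a b c hab O u hB⟩

end Reduced

end MultiGraph

end PercRepro
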